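import Summits.NavierStokesRegularity.FluidComputer.RotorKnobPulseFire
import HarnessLib

/-!
# The seed–rotor scale knob under the PULSE hypothesis, part 2: (douse) and (atc) on the horizon

Companion of `RotorKnobPulseFire.lean` (cell `pub-fluidc`, blueprint seat bp1, gen 24; ONE text
split by the 400-line rule; namespace `Summit.NavierStokesRegularity.FluidComputer.RotorKnob`).
HONEST FRAMING (verbatim): low prior, high value-of-information experiment on Tao's machine
paradigm; NOT a claim that NS blows up. Setting of part 1: an exact trajectory of
`rotorCircuit K M ε ρ` from `delayInit`, the critical time `τ = t_c` (`c ≤ K⁻¹⁰ρ²` on `[0,τ]`,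
`c(τ) = K⁻¹⁰ρ²`), an onset delay `δ ≥ 0` with `K¹¹⁰ ≤ e^{Mδ/8}`, a horizon `T ≤ 2` and the PULSE
HYPOTHESIS (hρT) `64·M·ρ⁴·e^{4M(T-τ)} ≤ ε²K²⁰` in place of gen 22's `ρ⁴ ≤ ε²e^{-18M}/(64M)`;
nothing is proved about Navier–Stokes.

THIS FILE (§PhaseTwo–§PhaseThree of the printed bootstrap, horizon `T`): `V_remainder_on` (the
remainder of `∂ₜV`, `V = adρ²/c`, is `≤ 9K⁻⁹⁰` on `I = [τ + δ, T]`; `∂ₜV` itself is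
`RotorKnob.hasDerivAt_V`, reused), `e_tenth_on` (**(atc)**: `ã(τ + δ + 1/K) ≥ 1/10` once
`τ + δ + 1/K ≤ T`), `Es_dissipation_on` (the `E_*`-dissipation inequality on `[τ + δ + 1/K, T]`;
the algebra is `Thm53.Es_alg`, reused). Port of `AmplitudeKnobDouse.lean` (gen 20, the diagonal
`ρ = ε`) along the seed–rotor scale.
[cite: Tao2016AveragedNS, §5.5 Thm 5.3 proof: (douse), (atc), (toke)]. No named facts; 0 sorry.
-/

noncomputable section

namespace Summit.NavierStokesRegularity.FluidComputer.RotorKnob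

open Set Real Filter
open _root_.Topology
open Literature.Analysis.FluidPDE.Tao2016AveragedNS
open Literature.Analysis.FluidPDE.Tao2016AveragedNS.Thm53 (monotoneOn_sub_of_le_deriv invSqrt_facts
  Es_alg)

section PulseDouse

variable {K M ε ρ τ δ T : ℝ} {X : ℝ → Fin 5 → ℝ}


/-! ## (douse): the remainder of `∂ₜV` on `I = [τ + δ, T]` -/

/-- Size of the remainder in `∂ₜV` on `I = [τ + δ, T]`: `|R| ≤ 9K⁻⁹⁰` (uses `ρ²/c ≤ K⁻¹⁰⁰`,
`0 ≤ ∂ₜc ≤ 6K¹⁰c`, all modes `O(1)`). [cite: Tao2016AveragedNS, §5.5 (douse)] -/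
theorem V_remainder_on (hX : ∀ t, HasDerivAt X (rotorCircuit K M ε ρ (X t)) t)
    (h0 : X 0 = delayInit)
    (hε : 0 < ε) (hε1 : ε ≤ 1) (hρ : 0 < ρ) (hρε : ρ ^ 2 ≤ ε) (hM0 : 0 < M) (hMK : M ≤ K ^ 10)
    (hK : 16 ≤ K)
    (hεK : ε ^ 2 ≤ 1 / (6 * K ^ 20)) (hMρ : M * ρ ^ 4 ≤ ε ^ 2) (hKM : exp (-M) ≤ 1 / K ^ 10)
    (hδ : 0 ≤ δ) (hon : K ^ 110 ≤ exp (M * δ / 8))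
    (hτ1 : 1 ≤ τ) (hτT : τ ≤ T) (hT2 : T ≤ 2)
    (hρT : 64 * M * ρ ^ 4 * exp (4 * M * (T - τ)) ≤ ε ^ 2 * K ^ 20)
    (hcτ : ∀ t, 0 ≤ t → t ≤ τ → X t 2 ≤ ρ ^ 2 / K ^ 10) (hcτeq : X τ 2 = ρ ^ 2 / K ^ 10)
    {t : ℝ} (ht : t ∈ Icc (τ + δ) T) :
    |(-(ε * X t 0 * X t 1 * X t 3 + ρ ^ 2 * exp (-M) * X t 0 * X t 2 * X t 3
            + K * X t 0 * X t 3 * X t 4) * (ρ ^ 2 * (X t 2)⁻¹)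
          - X t 0 * X t 3 * (ρ ^ 2 * (X t 2)⁻¹) *
            ((ρ ^ 2 * exp (-M) * X t 0 ^ 2 + ε⁻¹ * M * X t 1 * X t 2) * (X t 2)⁻¹))|
      ≤ 9 / K ^ 90 := by
  have hK0 : 0 < K := by linarith
  have hK1 : 1 ≤ K := by linarith
  have hcl : K ^ 100 * ρ ^ 2 ≤ X t 2 :=
    c_large_on hX h0 hε hρ hρε hM0 hK hεK hMρ hKM hδ hon hτ1 hτT hT2 hρT hcτ hcτeq ht
  have hcpos : 0 < X t 2 := lt_of_lt_of_le (by positivity) hcl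
  obtain ⟨hc'0, hc'6⟩ :=
    c_deriv_bounds_on hX h0 hε hρ hρε hM0 hMK hK hεK hMρ hKM hδ hon hτ1 hτT hT2 hρT hcτ hcτeq ht
  set q : ℝ := ρ ^ 2 * (X t 2)⁻¹ with hq
  have hq0 : 0 ≤ q := by positivity
  have hq1 : q ≤ 1 / K ^ 100 := by
    simp only [hq]
    rw [← div_eq_mul_inv, div_le_div_iff₀ hcpos (by positivity), one_mul]
    linarith
  set c' : ℝ := ρ ^ 2 * exp (-M) * X t 0 ^ 2 + ε⁻¹ * M * X t 1 * X t 2 with hc'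
  have hrat0 : 0 ≤ c' * (X t 2)⁻¹ := by positivity
  have hrat : c' * (X t 2)⁻¹ ≤ 6 * K ^ 10 := by
    rw [← div_eq_mul_inv, div_le_iff₀ hcpos]; exact hc'6
  have ha : |X t 0| ≤ 1 := traj_abs_le_one hX h0 t 0
  have hb : |X t 1| ≤ 1 := traj_abs_le_one hX h0 t 1
  have hc : |X t 2| ≤ 1 := traj_abs_le_one hX h0 t 2
  have hd : |X t 3| ≤ 1 := traj_abs_le_one hX h0 t 3
  have he : |X t 4| ≤ 1 := traj_abs_le_one hX h0 t 4
  -- term 1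
  have hT1 : |(-(ε * X t 0 * X t 1 * X t 3 + ρ ^ 2 * exp (-M) * X t 0 * X t 2 * X t 3
      + K * X t 0 * X t 3 * X t 4) * q)| ≤ (2 + K) * (1 / K ^ 100) := by
    rw [abs_mul, abs_neg, abs_of_nonneg hq0]
    have hin : |ε * X t 0 * X t 1 * X t 3 + ρ ^ 2 * exp (-M) * X t 0 * X t 2 * X t 3
        + K * X t 0 * X t 3 * X t 4| ≤ 2 + K := by
      have e1 : |ε * X t 0 * X t 1 * X t 3| ≤ 1 := by
        rw [abs_mul, abs_mul, abs_mul, abs_of_pos hε]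
        calc ε * |X t 0| * |X t 1| * |X t 3| ≤ 1 * 1 * 1 * 1 := by gcongr
          _ = 1 := by ring
      have e2 : |ρ ^ 2 * exp (-M) * X t 0 * X t 2 * X t 3| ≤ 1 := by
        have hμ1 : ρ ^ 2 * exp (-M) ≤ 1 := by
          have hek : exp (-M) ≤ 1 := by rw [exp_le_one_iff, neg_nonpos]; exact hM0.le
          calc ρ ^ 2 * exp (-M) ≤ ε * 1 := mul_le_mul hρε hek (exp_pos _).le hε.le
            _ ≤ 1 := by rw [mul_one]; exact hε1
        rw [abs_mul, abs_mul, abs_mul, abs_of_nonneg (by positivity : 0 ≤ ρ ^ 2 * exp (-M))]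
        calc ρ ^ 2 * exp (-M) * |X t 0| * |X t 2| * |X t 3| ≤ 1 * 1 * 1 * 1 := by gcongr
          _ = 1 := by ring
      have e3 : |K * X t 0 * X t 3 * X t 4| ≤ K := by
        rw [abs_mul, abs_mul, abs_mul, abs_of_pos hK0]
        calc K * |X t 0| * |X t 3| * |X t 4| ≤ K * 1 * 1 * 1 := by gcongr
          _ = K := by ring
      calc _ ≤ |ε * X t 0 * X t 1 * X t 3 + ρ ^ 2 * exp (-M) * X t 0 * X t 2 * X t 3|
            + |K * X t 0 * X t 3 * X t 4| := abs_add_le _ _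
        _ ≤ |ε * X t 0 * X t 1 * X t 3| + |ρ ^ 2 * exp (-M) * X t 0 * X t 2 * X t 3|
            + |K * X t 0 * X t 3 * X t 4| := by
            have := abs_add_le (ε * X t 0 * X t 1 * X t 3)
              (ρ ^ 2 * exp (-M) * X t 0 * X t 2 * X t 3)
            linarith
        _ ≤ 2 + K := by linarith
    exact mul_le_mul hin hq1 hq0 (by positivity)
  -- term 2
  have hT2' : |X t 0 * X t 3 * q * (c' * (X t 2)⁻¹)| ≤ 6 * K ^ 10 * (1 / K ^ 100) := by
    rw [abs_mul, abs_mul, abs_mul, abs_of_nonneg hq0, abs_of_nonneg hrat0]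
    calc |X t 0| * |X t 3| * q * (c' * (X t 2)⁻¹) ≤ 1 * 1 * (1 / K ^ 100) * (6 * K ^ 10) := by
          gcongr
      _ = 6 * K ^ 10 * (1 / K ^ 100) := by ring
  have hsum : (2 + K) * (1 / K ^ 100) + 6 * K ^ 10 * (1 / K ^ 100) ≤ 9 / K ^ 90 := by
    have h10 : 2 + K ≤ 3 * K ^ 10 := by
      have : K ≤ K ^ 10 := le_self_pow₀ hK1 (by norm_num)
      linarith
    rw [show 9 / K ^ 90 = 9 * K ^ 10 * (1 / K ^ 100) by field_simp]
    have : 0 ≤ 1 / K ^ 100 := by positivity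
    nlinarith
  calc _ ≤ |(-(ε * X t 0 * X t 1 * X t 3 + ρ ^ 2 * exp (-M) * X t 0 * X t 2 * X t 3
        + K * X t 0 * X t 3 * X t 4) * q)| + |X t 0 * X t 3 * q * (c' * (X t 2)⁻¹)| :=
        abs_sub _ _
    _ ≤ (2 + K) * (1 / K ^ 100) + 6 * K ^ 10 * (1 / K ^ 100) := add_le_add hT1 hT2'
    _ ≤ 9 / K ^ 90 := hsum

/-! ## (atc): the output reaches `1/10` within time `1/K` of the onset -/

/-- **(atc) on the horizon `T`.** With `σ = τ + δ` and `σ + 1/K ≤ T`: `ã(σ + 1/K) ≥ 1/10`. If not,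
`ã ≤ 0.1` on `J = [σ, σ + 1/K]` (monotone), so `d² = (1-ã²) - a² - b² - c² ≥ 0.98 - a²` and
`Ψ = V + (2/K)ã` has `∂ₜΨ = 1 - 2a² + 2d²·… ≥ 0.97` on `J`, against a total variation
`≤ 2K⁻¹⁰⁰ + 0.2/K` over `J` — a contradiction. [cite: Tao2016AveragedNS, §5.5 (atc)] -/
theorem e_tenth_on (hX : ∀ t, HasDerivAt X (rotorCircuit K M ε ρ (X t)) t) (h0 : X 0 = delayInit)
    (hε : 0 < ε) (hε1 : ε ≤ 1) (hρ : 0 < ρ) (hρε : ρ ^ 2 ≤ ε) (hM0 : 0 < M) (hMK : M ≤ K ^ 10)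
    (hK : 16 ≤ K)
    (hεK : ε ^ 2 ≤ 1 / (6 * K ^ 20)) (hMρ : M * ρ ^ 4 ≤ ε ^ 2) (hKM : exp (-M) ≤ 1 / K ^ 10)
    (hδ : 0 ≤ δ) (hon : K ^ 110 ≤ exp (M * δ / 8))
    (hτ1 : 1 ≤ τ) (hfit : τ + δ + K⁻¹ ≤ T) (hT2 : T ≤ 2)
    (hρT : 64 * M * ρ ^ 4 * exp (4 * M * (T - τ)) ≤ ε ^ 2 * K ^ 20)
    (hcτ : ∀ t, 0 ≤ t → t ≤ τ → X t 2 ≤ ρ ^ 2 / K ^ 10) (hcτeq : X τ 2 = ρ ^ 2 / K ^ 10) :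
    1 / 10 ≤ X (τ + δ + K⁻¹) 4 := by
  have hK0 : 0 < K := by linarith
  have hK1 : 1 ≤ K := by linarith
  have hu0' : 0 < K⁻¹ := inv_pos.2 hK0
  have hτT : τ ≤ T := by linarith
  set t₀ : ℝ := τ + δ with ht₀
  set t₁ : ℝ := τ + δ + K⁻¹ with ht₁
  have ht₀0 : 0 ≤ t₀ := by simp only [ht₀]; linarith
  have h01 : t₀ ≤ t₁ := by simp only [ht₀, ht₁]; linarith
  have ht1T : t₁ ≤ T := by simp only [ht₁]; exact hfit
  have hJI : ∀ s ∈ Icc t₀ t₁, s ∈ Icc (τ + δ) T := fun s hs => ⟨hs.1, hs.2.trans ht1T⟩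
  -- numeric facts
  have hK20 : (2 : ℝ) ^ 20 ≤ K ^ 20 := pow_le_pow_left₀ (by norm_num) (by linarith) 20
  have hε2 : (5 * ε) ^ 2 ≤ 1 / 1000 := by
    have h6 : 1 / (6 * K ^ 20) ≤ 1 / 25000 := by
      apply one_div_le_one_div_of_le (by norm_num); linarith
    have : (5 * ε) ^ 2 = 25 * ε ^ 2 := by ring
    rw [this]; linarith
  have hK90 : (2 : ℝ) ^ 90 ≤ K ^ 90 := pow_le_pow_left₀ (by norm_num) (by linarith) 90
  have hK90' : 9 / K ^ 90 ≤ 1 / 1000 := by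
    rw [div_le_div_iff₀ (by positivity) (by norm_num)]; linarith
  by_contra hlt'
  have hlt := not_le.1 hlt'
  have hmonoE := rotorCircuit_output_monotone hK0.le hX
  -- `Ψ = V + (2/K) ã` has derivative `≥ 0.97` on `J`
  have hmono := monotoneOn_sub_of_le_deriv (φ := fun _ => (97 : ℝ) / 100)
    (Φ := fun s => 97 / 100 * s) (convex_Icc t₀ t₁)
    (f := fun s => X s 0 * X s 3 * (ρ ^ 2 * (X s 2)⁻¹) + 2 / K * X s 4)
    (fun s hs => by
      have hsI := hJI s hs
      have hcl : K ^ 100 * ρ ^ 2 ≤ X s 2 :=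
        c_large_on hX h0 hε hρ hρε hM0 hK hεK hMρ hKM hδ hon hτ1 hτT hT2 hρT hcτ hcτeq hsI
      have hcne : X s 2 ≠ 0 := (lt_of_lt_of_le (by positivity) hcl).ne'
      exact (hasDerivAt_V hX hε.ne' hρ.ne' hcne).add ((hasDerivAt_e hX s).const_mul (2 / K)))
    (fun s _ => ((hasDerivAt_id s).const_mul ((97 : ℝ) / 100)).congr_deriv (by simp))
    (fun s hs => by
      have hsI := hJI s hs
      have hs02 : s ∈ Icc (0 : ℝ) 2 := ⟨by linarith [hs.1, ht₀0], hsI.2.trans hT2⟩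
      have hR :=
        V_remainder_on hX h0 hε hε1 hρ hρε hM0 hMK hK hεK hMρ hKM hδ hon hτ1 hτT hT2 hρT hcτ hcτeq
            hsI
      have hRlo := (abs_le.1 hR).1
      have hsum := traj_sum_sq_eq_one hX h0 s
      obtain ⟨hb5, hc5⟩ := bc_small hX h0 hε hρ hρε hM0.le hs02
      have hb2 : X s 1 ^ 2 ≤ (5 * ε) ^ 2 := by
        rw [← sq_abs]; exact pow_le_pow_left₀ (abs_nonneg _) hb5 2
      have hc2 : X s 2 ^ 2 ≤ (5 * ε) ^ 2 := by
        rw [← sq_abs]; exact pow_le_pow_left₀ (abs_nonneg _) hc5 2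
      have hes : X s 4 ≤ 1 / 10 := (hmonoE hs.2).trans hlt.le
      have hes0 : 0 ≤ X s 4 := e_nonneg hX h0 hK0.le hs02.1
      have he2 : X s 4 ^ 2 ≤ 1 / 100 := by
        have := pow_le_pow_left₀ hes0 hes 2; norm_num at this; exact this
      have hKd : 2 / K * (K * X s 3 ^ 2) = 2 * X s 3 ^ 2 := by field_simp
      rw [hKd]
      linarith)
  have hmem0 : t₀ ∈ Icc t₀ t₁ := ⟨le_rfl, h01⟩
  have hmem1 : t₁ ∈ Icc t₀ t₁ := ⟨h01, le_rfl⟩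
  have h := hmono hmem0 hmem1 h01
  simp only at h
  -- sizes of `V` at the endpoints and of `ã`
  have hV : ∀ s ∈ Icc t₀ t₁, |X s 0 * X s 3 * (ρ ^ 2 * (X s 2)⁻¹)| ≤ 1 / K ^ 100 := by
    intro s hs
    have hsI := hJI s hs
    have hcl : K ^ 100 * ρ ^ 2 ≤ X s 2 :=
      c_large_on hX h0 hε hρ hρε hM0 hK hεK hMρ hKM hδ hon hτ1 hτT hT2 hρT hcτ hcτeq hsI
    have hcpos : 0 < X s 2 := lt_of_lt_of_le (by positivity) hcl
    have hq0 : 0 ≤ ρ ^ 2 * (X s 2)⁻¹ := by positivity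
    have hq : ρ ^ 2 * (X s 2)⁻¹ ≤ 1 / K ^ 100 := by
      rw [← div_eq_mul_inv, div_le_div_iff₀ hcpos (by positivity), one_mul]; linarith
    rw [abs_mul, abs_mul, abs_of_nonneg hq0]
    calc |X s 0| * |X s 3| * (ρ ^ 2 * (X s 2)⁻¹) ≤ 1 * 1 * (1 / K ^ 100) :=
          mul_le_mul (mul_le_mul (traj_abs_le_one hX h0 s 0) (traj_abs_le_one hX h0 s 3)
            (abs_nonneg _) zero_le_one) hq hq0 (by norm_num)
      _ = 1 / K ^ 100 := by ring
  have hV0 := (abs_le.1 (hV t₀ hmem0)).1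
  have hV1 := (abs_le.1 (hV t₁ hmem1)).2
  have he0 : 0 ≤ X t₀ 4 := e_nonneg hX h0 hK0.le ht₀0
  have hlen : t₁ - t₀ = K⁻¹ := by simp only [ht₀, ht₁]; ring
  -- numeric contradiction, in the variable `u = 1/K`
  set u : ℝ := K⁻¹ with hu
  have hu0 : 0 < u := by positivity
  have hK8 : (2 : ℝ) ^ 8 ≤ K ^ 8 := pow_le_pow_left₀ (by norm_num) (by linarith) 8
  have hK99 : (2 : ℝ) ^ 8 ≤ K ^ 99 := hK8.trans (pow_le_pow_right₀ hK1 (by norm_num))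
  have hi99 : (K ^ 99)⁻¹ ≤ 1 / 256 := by
    rw [one_div, inv_le_inv₀ (by positivity) (by norm_num)]; linarith
  have h100 : 1 / K ^ 100 ≤ u * (1 / 256) := by
    rw [show 1 / K ^ 100 = u * (K ^ 99)⁻¹ by
      simp only [hu]; rw [← mul_inv, ← pow_succ', one_div]]
    exact mul_le_mul_of_nonneg_left hi99 hu0.le
  have hKu : 2 / K * X t₁ 4 - 2 / K * X t₀ 4 ≤ 2 * u * (1 / 10) := by
    have : 2 / K * X t₁ 4 - 2 / K * X t₀ 4 = 2 * u * (X t₁ 4 - X t₀ 4) := by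
      simp only [hu]; ring
    rw [this]
    exact mul_le_mul_of_nonneg_left (by linarith) (by positivity)
  have hfin : 97 / 100 * (t₁ - t₀) ≤ 2 * (u * (1 / 256)) + 2 * u * (1 / 10) := by linarith
  rw [hlen] at hfin
  linarith

/-! ## The equipartition energy `E_*`: dissipation on `[σ + 1/K, T]` -/

/-- Dissipation inequality for `E_* = ½(1-ã²) - ½K·V·ã` on `[t', T]`, `t' = τ + δ + 1/K`:
`∂ₜE_* + Kã(t')E_* ≤ 7K⁻⁸⁹` (the derivative is `RotorKnob.hasDerivAt_Es`, the algebra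
`Thm53.Es_alg`).
[cite: Tao2016AveragedNS, §5.5 (proof of (beable))] -/
theorem Es_dissipation_on (hX : ∀ t, HasDerivAt X (rotorCircuit K M ε ρ (X t)) t)
    (h0 : X 0 = delayInit)
    (hε : 0 < ε) (hε1 : ε ≤ 1) (hρ : 0 < ρ) (hρε : ρ ^ 2 ≤ ε) (hM0 : 0 < M) (hMK : M ≤ K ^ 10)
    (hK : 16 ≤ K)
    (hεK : ε ^ 2 ≤ 1 / (6 * K ^ 20)) (hMρ : M * ρ ^ 4 ≤ ε ^ 2) (hε100 : ε ≤ 1 / K ^ 100)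
    (hKM : exp (-M) ≤ 1 / K ^ 10)
    (hδ : 0 ≤ δ) (hon : K ^ 110 ≤ exp (M * δ / 8))
    (hτ1 : 1 ≤ τ) (hfit : τ + δ + K⁻¹ ≤ T) (hT2 : T ≤ 2)
    (hρT : 64 * M * ρ ^ 4 * exp (4 * M * (T - τ)) ≤ ε ^ 2 * K ^ 20)
    (hcτ : ∀ t, 0 ≤ t → t ≤ τ → X t 2 ≤ ρ ^ 2 / K ^ 10) (hcτeq : X τ 2 = ρ ^ 2 / K ^ 10)
    {s : ℝ} (hs : s ∈ Icc (τ + δ + K⁻¹) T) :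
    (-(K / 2) * X s 4 * (X s 0 ^ 2 + X s 3 ^ 2)
        - K / 2 * ((-(ε * X s 0 * X s 1 * X s 3 + ρ ^ 2 * exp (-M) * X s 0 * X s 2 * X s 3
            + K * X s 0 * X s 3 * X s 4) * (ρ ^ 2 * (X s 2)⁻¹)
          - X s 0 * X s 3 * (ρ ^ 2 * (X s 2)⁻¹) *
            ((ρ ^ 2 * exp (-M) * X s 0 ^ 2 + ε⁻¹ * M * X s 1 * X s 2) * (X s 2)⁻¹)))
          * X s 4
        - K ^ 2 / 2 * (X s 0 * X s 3 * (ρ ^ 2 * (X s 2)⁻¹)) * X s 3 ^ 2)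
      + K * X (τ + δ + K⁻¹) 4 * ((1 - X s 4 * X s 4) / 2
        - K / 2 * (X s 0 * X s 3 * (ρ ^ 2 * (X s 2)⁻¹) * X s 4)) ≤ 7 / K ^ 89 := by
  have hK0 : 0 < K := by linarith
  have hu0' : 0 < K⁻¹ := inv_pos.2 hK0
  have hτT : τ ≤ T := by linarith
  have hsI : s ∈ Icc (τ + δ) T := ⟨by linarith [hs.1], hs.2⟩
  have hs02 : s ∈ Icc (0 : ℝ) 2 := ⟨by linarith [hs.1], hs.2.trans hT2⟩
  have hcl : K ^ 100 * ρ ^ 2 ≤ X s 2 :=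
    c_large_on hX h0 hε hρ hρε hM0 hK hεK hMρ hKM hδ hon hτ1 hτT hT2 hρT hcτ hcτeq hsI
  have hcpos : 0 < X s 2 := lt_of_lt_of_le (by positivity) hcl
  have hq0 : 0 ≤ ρ ^ 2 * (X s 2)⁻¹ := by positivity
  have hq1 : ρ ^ 2 * (X s 2)⁻¹ ≤ 1 / K ^ 100 := by
    rw [← div_eq_mul_inv, div_le_div_iff₀ hcpos (by positivity), one_mul]; linarith
  obtain ⟨hb5, hc5⟩ := bc_small hX h0 hε hρ hρε hM0.le hs02
  have hb2 : X s 1 ^ 2 ≤ (5 * ε) ^ 2 := by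
    rw [← sq_abs]; exact pow_le_pow_left₀ (abs_nonneg _) hb5 2
  have hc2 : X s 2 ^ 2 ≤ (5 * ε) ^ 2 := by
    rw [← sq_abs]; exact pow_le_pow_left₀ (abs_nonneg _) hc5 2
  have hmonoE := rotorCircuit_output_monotone hK0.le hX
  exact Es_alg hK (traj_sum_sq_eq_one hX h0 s) hq0 hq1
    (V_remainder_on hX h0 hε hε1 hρ hρε hM0 hMK hK hεK hMρ hKM hδ hon hτ1 hτT hT2 hρT hcτ hcτeq hsI)
    (traj_abs_le_one hX h0 s 0) (traj_abs_le_one hX h0 s 3) (traj_abs_le_one hX h0 s 4)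
    (e_nonneg hX h0 hK0.le (by linarith))
    ((le_abs_self _).trans (traj_abs_le_one hX h0 _ 4)) (hmonoE hs.1) hb2 hc2 hε hε1 hε100

end PulseDouse

end Summit.NavierStokesRegularity.FluidComputer.RotorKnob
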